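/- Copyright: the b2b-balaban cell (near-miss cell 7), T⁴-continuum fan-out, lineage t4-ne7b-p1 (node U5c COUNT
member).  Released under the licence of the surrounding project. -/
import Summits.QuantumFields.BalabanUV.T4Continuum.Support.HistoryGenealogyDissolveWF
import Summits.QuantumFields.BalabanUV.T4Continuum.Support.HistoryGenealogyExtractionRLedger

/-!
# DISSOLVING THE FRESH CLUSTERS (junction M4, pass V, part 4a — the event products are unchanged): dissolving the
fresh clusters re-indexes the bookkeeping WITHOUT changing any event product — a real component's dissolved genealogy
has the same product of birth and renewal factors (joins carry none), a fresh cluster's product is the product of its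
regions' birth factors, and so every per-level product over the components, the live products and the dead products
agree; likewise any per-component weight that is MULTIPLICATIVE over a fresh cluster's regions (the volume form of the
per-level cost) has the same per-level product (owner module of row NE7b, lineage `t4-ne7b-p1` gen 42; ruling
R-OWNER-42-1; the «pass V bridge» promised to IR-41-8 M2 brick B in the owner's SHAPE ANSWER, `CLAIMS.log` — so that
`weight_le_evProd` stays over print's bookkeeping and composes with the pass-V junction; re-open object (α),
`SCOPE-alpha.md` v2.3 §5 rows M2∕M4∕M5 — PRE-POSITIONING ONLY)

Summits-side support leaf of the T⁴-continuum cell (rung (B)+1 on a FINITE torus only; NOT infinite volume, NOT the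
mass gap, NOT the Clay statement; NOT a proof of the spine estimate NE7b, which is the cell's OWN estimate, NOT PRINTED
and NOT PROVED).  [folklore] finite combinatorics over parts 1a∕1b (`dissolve`, `Fresh`, `pseudo`, `partV`, `splice`,
`SpliceOK`, `LabelOK`) and row S13-R's ledger (`HistoryGenealogyExtractionRLedger`: `evProd`, `rfacs`, `died`,
`evProd_pgenR_succ`∕`_zero`); PROCESS-AGNOSTIC; nothing printed is asserted, no `def … : Prop` fact of Bałaban's, no
cite-tagged hypothesis, zero `sorry`.  B16 = [Balaban1989LargeFieldII] pp. 383–386 under audit; locators only.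

WHAT.  §1 `prod_map_splice` (a product over a spliced list equals the product over the list when each replacement's
product is the replaced value); §2 `evProd_pgenR_fresh` (a fresh cluster: the product of its regions' births),
`evProd_pgenR_dissolve_pseudo` (a pseudo-component: its region's birth), `rfacs_dissolve` (renewal factors of the
parts unchanged — pseudo-parts and fresh parts are unflagged), **`evProd_pgenR_dissolve`** (every real non-fresh
component: SAME event product; induction through print's five cases); §3 **`prod_dissolve_eq`** (the re-indexing: a
product over `(S ∖ fresh) ∪ ⋃_{fresh c ∈ S} news c` of a function agreeing with `φ` on real components and
multiplying up to `φ` over each fresh cluster's regions equals `∏_{S} φ`), hence **`prod_comp_dissolve_evProd`** (live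
products agree at every level), `continued_dissolve_iff`∕`died_dissolve_eq` and **`prod_died_dissolve_evProd`** (dead
products agree), and **`prod_comp_dissolve_of_mul`** (any weight multiplicative over a fresh cluster's regions — e.g.
`Λ ^ #domain` under disjoint regions — has the same per-level product).

HONEST.  Proves nothing of Bałaban's; a re-indexing of OUR bookkeeping; by-name class of every `WALL-NE7b-P1.md` §2
binder UNCHANGED; NE7b NOT proved; spine 0∕9.  HONEST DEPENDENCY (cell): continuum YM on T⁴ ⇐ BetaPertH ∧ nine spine
estimates (0/9 proved); BetaPertH ⇐ (D1) ∧ (D4) ∧ CAP+tail; G-an2-4 gates asym, D1 and NE2/3/4.  This file changes none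
of it. -/

open Finset
open Literature.MathematicalPhysics.QuantumFieldTheory.Balaban1983to89
open Summit.QuantumFields.BalabanUV.T4Continuum.HistoryAdmissible
open Summit.QuantumFields.BalabanUV.T4Continuum.HistoryGenealogyExtraction

namespace Summit.QuantumFields.BalabanUV.T4Continuum.HistoryGenealogyExtraction

noncomputable section

open Classical

/-! ## §1 Products over spliced lists -/

section Splice

variable {α β M : Type*} [CommMonoid M]

/-- **A PRODUCT OVER A SPLICED LIST** equals the product over the list when every replacement multiplies up to the
replaced value. [folklore] -/
theorem prod_map_splice (pV : α → List α) (g g' : α ⊕ β → M)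
    (hl : ∀ p, ((pV p).map fun q => g (Sum.inl q)).prod = g' (Sum.inl p)) (hr : ∀ n, g (Sum.inr n) = g' (Sum.inr n)) :
    ∀ l : List (α ⊕ β), ((splice pV l).map g).prod = (l.map g').prod
  | [] => rfl
  | Sum.inl p :: l => by
      rw [splice_cons_inl, List.map_append, List.prod_append, List.map_map, List.map_cons, List.prod_cons,
        prod_map_splice pV g g' hl hr l, ← hl p]
      rfl
  | Sum.inr n :: l => by
      rw [splice_cons_inr, List.map_cons, List.map_cons, List.prod_cons, List.prod_cons, hr n,
        prod_map_splice pV g g' hl hr l]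

/-- a product over a `flatMap` is the product of the blockwise products [folklore] -/
theorem prod_map_flatMap {ι : Type*} (f : ι → List α) (g : α → M) :
    ∀ l : List ι, ((l.flatMap f).map g).prod = (l.map fun a => ((f a).map g).prod).prod
  | [] => rfl
  | a :: l => by
      rw [List.flatMap_cons, List.map_append, List.prod_append, List.map_cons, List.prod_cons, prod_map_flatMap f g l]

end Splice

/-! ## §2 Event products in the dissolved bookkeeping -/

namespace ComponentHistory

variable {γ : Type*} [DecidableEq γ] {H : ComponentHistory γ} {rnw : ℕ → γ → Bool} {spl : ℕ → γ → γ → List γ}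
  {M : Type*} [CommMonoid M] (fB : ℕ → ℕ → γ → M) (fR : ℕ → M)

/-- **A FRESH CLUSTER'S EVENT PRODUCT IS THE PRODUCT OF ITS REGIONS' BIRTH FACTORS** (no part, no renewal).
[folklore] -/
theorem evProd_pgenR_fresh (hW : H.WF) {j : ℕ} {c : γ} (hf : H.Fresh j c) :
    evProd fB fR (H.pgenR rnw j c) = ((H.news j c).map fun n => fB j (H.cls n) n).prod := by
  cases j with
  | zero => exact H.evProd_pgenR_zero rnw fB fR hW c hf.mem
  | succ j =>
      rw [H.evProd_pgenR_succ rnw fB fR hW j c hf.mem, rfacs, hf.parts_eq]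
      simp

/-- a pseudo-component's event product is its region's birth factor [folklore] -/
theorem evProd_pgenR_dissolve_pseudo {j : ℕ} {n : γ} (hn : n ∈ H.pseudo j) :
    evProd fB fR ((H.dissolve spl).pgenR rnw j n) = fB j (H.cls n) n := by
  cases j with
  | zero => rw [(H.dissolve spl).pgenR_zero_birth rnw n n (H.constit_dissolve_pseudo spl hn)]; rfl
  | succ j => rw [(H.dissolve spl).pgenR_succ_birth rnw j n n (H.constit_dissolve_pseudo spl hn)]; rfl

/-- **THE RENEWAL FACTORS OF THE PARTS ARE UNCHANGED** by the splice (fresh parts and their pseudo replacements are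
all unflagged). [folklore] -/
theorem rfacs_dissolve (hS : H.SpliceOK spl) (hL : H.LabelOK) (hFr : ∀ j c, H.Fresh j c → rnw j c = false)
    (hRnP : ∀ j n, n ∈ H.pseudo j → rnw j n = false) {j : ℕ} {c : γ} (hc : c ∈ H.comp (j + 1))
    (hf : ¬ H.Fresh (j + 1) c) : (H.dissolve spl).rfacs rnw fR (j + 1) c = H.rfacs rnw fR (j + 1) c := by
  have hp := not_mem_pseudo_of_mem_comp hL hc
  rw [rfacs, rfacs, Nat.add_sub_cancel, H.parts_dissolve_succ spl hc hf hp, prod_map_flatMap]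
  refine congrArg List.prod (List.map_congr_left fun p hpm => ?_)
  by_cases hfp : H.Fresh j p
  · rw [H.partV_of_fresh spl c hfp, hFr j p hfp]
    simp only [Bool.false_eq_true, if_false]
    refine List.prod_eq_one fun x hx => ?_
    obtain ⟨q, hq, rfl⟩ := List.mem_map.1 hx
    rw [hRnP j q (H.mem_pseudo_iff.2 ⟨p, hfp, (mem_spl_iff hS hc hpm hfp).1 hq⟩)]
    simp
  · rw [H.partV_of_not_fresh spl c hfp, List.map_singleton, List.prod_singleton]

/-- **EVERY REAL NON-FRESH COMPONENT HAS THE SAME EVENT PRODUCT** in the dissolved bookkeeping (induction through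
print's cases: the splice replaces a fresh part — whose product is its regions' births — by those births, and changes
nothing else; joins carry no factor). [folklore] -/
theorem evProd_pgenR_dissolve (hW : H.WF) (hS : H.SpliceOK spl) (hL : H.LabelOK)
    (hFr : ∀ j c, H.Fresh j c → rnw j c = false) (hRnP : ∀ j n, n ∈ H.pseudo j → rnw j n = false) :
    ∀ (j : ℕ) (x : γ), x ∈ H.comp j → ¬ H.Fresh j x →
      evProd fB fR ((H.dissolve spl).pgenR rnw j x) = evProd fB fR (H.pgenR rnw j x) := by
  have hW' : (H.dissolve spl).WF := wf_dissolve hW hS hL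
  intro j
  induction j with
  | zero =>
      intro x hx hf
      have hx' : x ∈ (H.dissolve spl).comp 0 := H.mem_comp_dissolve_of_real spl hx hf
      rw [(H.dissolve spl).evProd_pgenR_zero rnw fB fR hW' x hx', H.evProd_pgenR_zero rnw fB fR hW x hx,
        H.news_dissolve_real spl hx hf (not_mem_pseudo_of_mem_comp hL hx)]
      rfl
  | succ j ih =>
      intro x hx hf
      have hp := not_mem_pseudo_of_mem_comp hL hx
      have hx' : x ∈ (H.dissolve spl).comp (j + 1) := H.mem_comp_dissolve_of_real spl hx hf
      rw [(H.dissolve spl).evProd_pgenR_succ rnw fB fR hW' j x hx', H.evProd_pgenR_succ rnw fB fR hW j x hx,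
        rfacs_dissolve fR hS hL hFr hRnP hx hf, H.news_dissolve_real spl hx hf hp, H.parts_dissolve_succ spl hx hf hp,
        prod_map_flatMap]
      have hparts : ((H.parts (j + 1) x).map fun p =>
            ((H.partV spl j x p).map fun q => evProd fB fR ((H.dissolve spl).pgenR rnw j q)).prod).prod =
          ((H.parts (j + 1) x).map fun p => evProd fB fR (H.pgenR rnw j p)).prod := by
        refine congrArg List.prod (List.map_congr_left fun p hpm => ?_)
        have hpc : p ∈ H.comp j := hW.parts_sub j x hx p hpm
        by_cases hfp : H.Fresh j p
        · rw [H.partV_of_fresh spl x hfp, evProd_pgenR_fresh fB fR hW hfp,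
            ← ((hS j x p hx hpm hfp).map fun n => fB j (H.cls n) n).prod_eq]
          exact congrArg List.prod (List.map_congr_left fun q hq =>
            evProd_pgenR_dissolve_pseudo fB fR (H.mem_pseudo_iff.2 ⟨p, hfp, (mem_spl_iff hS hx hpm hfp).1 hq⟩))
        · rw [H.partV_of_not_fresh spl x hfp, List.map_singleton, List.prod_singleton]
          exact ih p hpc hfp
      rw [hparts]
      rfl

/-! ## §3 Re-indexing the per-level products -/

/-- the set standing in for `S` in the dissolved bookkeeping: its non-fresh members and the regions of its fresh
members [folklore] -/
def dissolveSet (H : ComponentHistory γ) (j : ℕ) (S : Finset γ) : Finset γ :=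
  (S.filter fun c => ¬ H.Fresh j c) ∪ (S.filter fun c => H.Fresh j c).biUnion fun c => (H.news j c).toFinset

/-- the dissolved components are the dissolved set of the components [folklore] -/
theorem comp_dissolve_eq (j : ℕ) : (H.dissolve spl).comp j = dissolveSet H j (H.comp j) := by
  ext x
  rw [mem_comp_dissolve_iff, dissolveSet, Finset.mem_union, Finset.mem_filter]
  rfl

/-- **THE RE-INDEXING IDENTITY**: for `S ⊆ comp j`, a function `φ'` that agrees with `φ` on the non-fresh members and
whose product over each fresh member's regions is `φ` of that member has `∏_{dissolveSet S} φ' = ∏_{S} φ` (under `WF`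
and the label condition: the pieces are pairwise disjoint). [folklore] -/
theorem prod_dissolveSet_eq (hW : H.WF) (hL : H.LabelOK) {j : ℕ} {S : Finset γ} (hS : S ⊆ H.comp j) (φ φ' : γ → M)
    (hreal : ∀ c ∈ S, ¬ H.Fresh j c → φ' c = φ c)
    (hfresh : ∀ c ∈ S, H.Fresh j c → ((H.news j c).map φ').prod = φ c) :
    ∏ x ∈ dissolveSet H j S, φ' x = ∏ c ∈ S, φ c := by
  rw [dissolveSet, Finset.prod_union, Finset.prod_biUnion]
  · rw [← Finset.prod_filter_mul_prod_filter_not S (fun c => ¬ H.Fresh j c)]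
    congr 1
    · exact Finset.prod_congr rfl fun c hc => by
        rw [Finset.mem_filter] at hc; exact hreal c hc.1 hc.2
    · have : (S.filter fun c => ¬¬ H.Fresh j c) = S.filter fun c => H.Fresh j c :=
        Finset.filter_congr fun c _ => not_not
      rw [this]
      refine Finset.prod_congr rfl fun c hc => ?_
      rw [Finset.mem_filter] at hc
      rw [List.prod_toFinset _ (hW.news_nodup j c), hfresh c hc.1 hc.2]
  · -- regions of distinct fresh clusters are disjoint
    intro c hc c' hc' hne
    rw [Finset.mem_coe, Finset.mem_filter] at hc hc'
    simpa only [Function.onFun] using hW.news_disj j c c' (hS hc.1) (hS hc'.1) hne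
  · -- a region of a fresh cluster is no real component
    rw [Finset.disjoint_left]
    intro x hx hx'
    rw [Finset.mem_filter] at hx
    rw [Finset.mem_biUnion] at hx'
    obtain ⟨c, hc, hxc⟩ := hx'
    rw [Finset.mem_filter] at hc
    exact hL j c hc.2 x (List.mem_toFinset.1 hxc) (hS hx.1)

/-- **LIVE PRODUCTS AGREE**: at every level the product of the event products over the dissolved components equals
the product over print's components. [folklore] -/
theorem prod_comp_dissolve_evProd (hW : H.WF) (hS : H.SpliceOK spl) (hL : H.LabelOK)
    (hFr : ∀ j c, H.Fresh j c → rnw j c = false) (hRnP : ∀ j n, n ∈ H.pseudo j → rnw j n = false) (j : ℕ) :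
    ∏ x ∈ (H.dissolve spl).comp j, evProd fB fR ((H.dissolve spl).pgenR rnw j x) =
      ∏ c ∈ H.comp j, evProd fB fR (H.pgenR rnw j c) := by
  rw [comp_dissolve_eq]
  refine prod_dissolveSet_eq hW hL (subset_of_eq rfl) _ _ (fun c hc hf => evProd_pgenR_dissolve fB fR hW hS hL hFr hRnP j c hc hf)
    fun c hc hf => ?_
  rw [evProd_pgenR_fresh fB fR hW hf]
  exact congrArg List.prod (List.map_congr_left fun n hn =>
    evProd_pgenR_dissolve_pseudo fB fR (H.mem_pseudo_iff.2 ⟨c, hf, hn⟩))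

/-- **ANY WEIGHT MULTIPLICATIVE OVER THE REGIONS OF A FRESH CLUSTER has the same per-level product** (the volume form
`Λ ^ #domain` of the per-level cost under disjoint regions covering the cluster is the intended instance). [folklore] -/
theorem prod_comp_dissolve_of_mul (hW : H.WF) (hL : H.LabelOK) (j : ℕ) (w : γ → M)
    (hmul : ∀ c ∈ H.comp j, H.Fresh j c → ((H.news j c).map w).prod = w c) :
    ∏ x ∈ (H.dissolve spl).comp j, w x = ∏ c ∈ H.comp j, w c := by
  rw [comp_dissolve_eq]
  exact prod_dissolveSet_eq hW hL (subset_of_eq rfl) w w (fun _ _ _ => rfl) hmul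

/-- a real non-fresh component is continued in the dissolved bookkeeping iff it is continued in print's [folklore] -/
theorem mem_continued_dissolve_iff_real (hS : H.SpliceOK spl) (hL : H.LabelOK) {j : ℕ} {x : γ} (hx : x ∈ H.comp j)
    (hf : ¬ H.Fresh j x) : x ∈ (H.dissolve spl).continued j ↔ x ∈ H.continued j := by
  simp only [continued, Finset.mem_biUnion, List.mem_toFinset]
  constructor
  · rintro ⟨c, hc, hxc⟩
    rcases real_or_pseudo hL hc with ⟨hcm, hcf, hcp⟩ | ⟨hcp, -⟩
    · rcases (H.mem_parts_dissolve_succ_iff spl hcm hcf hcp).1 hxc with ⟨hxm, -⟩ | ⟨p, hpm, hfp, hxp⟩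
      · exact ⟨c, hcm, hxm⟩
      · exact absurd hx (hL j p hfp x ((mem_spl_iff hS hcm hpm hfp).1 hxp))
    · rw [H.parts_dissolve_pseudo spl hcp] at hxc; simp at hxc
  · rintro ⟨c, hc, hxc⟩
    have hcf : ¬ H.Fresh (j + 1) c := H.not_fresh_of_parts_ne_nil (List.ne_nil_of_mem hxc)
    refine ⟨c, H.mem_comp_dissolve_of_real spl hc hcf, ?_⟩
    exact (H.mem_parts_dissolve_succ_iff spl hc hcf (not_mem_pseudo_of_mem_comp hL hc)).2 (Or.inl ⟨hxc, hf⟩)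

/-- a region of a fresh cluster is continued in the dissolved bookkeeping iff its cluster is continued in print's
[folklore] -/
theorem mem_continued_dissolve_iff_pseudo (hW : H.WF) (hS : H.SpliceOK spl) (hL : H.LabelOK) {j : ℕ} {c₀ n : γ}
    (hf : H.Fresh j c₀) (hn : n ∈ H.news j c₀) : n ∈ (H.dissolve spl).continued j ↔ c₀ ∈ H.continued j := by
  have hps : n ∈ H.pseudo j := H.mem_pseudo_iff.2 ⟨c₀, hf, hn⟩
  simp only [continued, Finset.mem_biUnion, List.mem_toFinset]
  constructor
  · rintro ⟨c, hc, hnc⟩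
    rcases real_or_pseudo hL hc with ⟨hcm, hcf, hcp⟩ | ⟨hcp, -⟩
    · rcases (H.mem_parts_dissolve_succ_iff spl hcm hcf hcp).1 hnc with ⟨hnm, -⟩ | ⟨p, hpm, hfp, hnp⟩
      · exact absurd (hW.parts_sub j c hcm n hnm) (not_mem_comp_of_mem_pseudo hL hps)
      · have hnp' := (mem_spl_iff hS hcm hpm hfp).1 hnp
        have : p = c₀ := by
          by_contra hne
          have := hW.news_disj j p c₀ hfp.mem hf.mem hne
          rw [List.disjoint_toFinset_iff_disjoint, List.disjoint_left] at this
          exact this hnp' hn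
        exact ⟨c, hcm, this ▸ hpm⟩
    · rw [H.parts_dissolve_pseudo spl hcp] at hnc; simp at hnc
  · rintro ⟨c, hc, hcc⟩
    have hcf : ¬ H.Fresh (j + 1) c := H.not_fresh_of_parts_ne_nil (List.ne_nil_of_mem hcc)
    refine ⟨c, H.mem_comp_dissolve_of_real spl hc hcf, ?_⟩
    exact (H.mem_parts_dissolve_succ_iff spl hc hcf (not_mem_pseudo_of_mem_comp hL hc)).2
      (Or.inr ⟨c₀, hcc, hf, (mem_spl_iff hS hc hcc hf).2 hn⟩)

/-- **THE DEAD OF THE DISSOLVED BOOKKEEPING are the dissolved set of print's dead.** [folklore] -/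
theorem died_dissolve_eq (hW : H.WF) (hS : H.SpliceOK spl) (hL : H.LabelOK) (j : ℕ) :
    (H.dissolve spl).died j = dissolveSet H j (H.died j) := by
  ext x
  rw [died, Finset.mem_sdiff, mem_comp_dissolve_iff, dissolveSet, Finset.mem_union, Finset.mem_filter,
    Finset.mem_biUnion]
  constructor
  · rintro ⟨hx | hx, hnc⟩
    · refine Or.inl ⟨?_, hx.2⟩
      rw [died, Finset.mem_sdiff]
      exact ⟨hx.1, fun h => hnc ((mem_continued_dissolve_iff_real hS hL hx.1 hx.2).2 h)⟩
    · obtain ⟨c₀, hf, hn⟩ := H.mem_pseudo_iff.1 hx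
      refine Or.inr ⟨c₀, ?_, List.mem_toFinset.2 hn⟩
      rw [Finset.mem_filter, died, Finset.mem_sdiff]
      exact ⟨⟨hf.mem, fun h => hnc ((mem_continued_dissolve_iff_pseudo hW hS hL hf hn).2 h)⟩, hf⟩
  · rintro (⟨hx, hf⟩ | ⟨c₀, hc₀, hn⟩)
    · rw [died, Finset.mem_sdiff] at hx
      exact ⟨Or.inl ⟨hx.1, hf⟩, fun h => hx.2 ((mem_continued_dissolve_iff_real hS hL hx.1 hf).1 h)⟩
    · rw [Finset.mem_filter, died, Finset.mem_sdiff] at hc₀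
      have hn' := List.mem_toFinset.1 hn
      exact ⟨Or.inr (H.mem_pseudo_iff.2 ⟨c₀, hc₀.2, hn'⟩),
        fun h => hc₀.1.2 ((mem_continued_dissolve_iff_pseudo hW hS hL hc₀.2 hn').1 h)⟩

/-- **DEAD PRODUCTS AGREE**: at every level the product of the event products over the dissolved dead equals the
product over print's dead. [folklore] -/
theorem prod_died_dissolve_evProd (hW : H.WF) (hS : H.SpliceOK spl) (hL : H.LabelOK)
    (hFr : ∀ j c, H.Fresh j c → rnw j c = false) (hRnP : ∀ j n, n ∈ H.pseudo j → rnw j n = false) (j : ℕ) :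
    ∏ x ∈ (H.dissolve spl).died j, evProd fB fR ((H.dissolve spl).pgenR rnw j x) =
      ∏ c ∈ H.died j, evProd fB fR (H.pgenR rnw j c) := by
  rw [died_dissolve_eq hW hS hL]
  refine prod_dissolveSet_eq hW hL (H.died_subset j) _ _
    (fun c hc hf => evProd_pgenR_dissolve fB fR hW hS hL hFr hRnP j c (H.died_subset j hc) hf) fun c hc hf => ?_
  rw [evProd_pgenR_fresh fB fR hW hf]
  exact congrArg List.prod (List.map_congr_left fun n hn =>
    evProd_pgenR_dissolve_pseudo fB fR (H.mem_pseudo_iff.2 ⟨c, hf, hn⟩))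

end ComponentHistory

end

end Summit.QuantumFields.BalabanUV.T4Continuum.HistoryGenealogyExtraction
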